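import Literature.AlgebraicTopology.SingularHomology.GysinMapSupport
import Literature.AlgebraicTopology.SingularHomology.PoincareDualityProofs
import Literature.AlgebraicTopology.SingularHomology.CohomologyMayerVietorisInjective
import Literature.AlgebraicTopology.SingularHomology.UniversalCoefficientsField
import Literature.AlgebraicTopology.SingularHomology.CompactSupports
import HarnessLib

/-!
# Gysin homomorphisms and restriction to open subsets — the named fact over a field, proved

W. Fulton, *Young Tableaux* (1997), App. B §B.2, Exercise 5 (with (26), (30)): Borel–Moore proper
push-forward commutes with restriction to an open `U ⊆ X` and `U' = f⁻¹U`; in SUPPORT FORM for the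
tree's Gysin homomorphism `f_! = D_X⁻¹ ∘ f_* ∘ D_Y` of a continuous map `f : Y → X` of closed
`R`-oriented topological manifolds (`GysinMap.lean`) this is the named fact
`gysinMap_restrictCompl_eq_zero R` of `GysinMapSupport.lean`: *if `y ∈ Hᵃ(Y; R)` restricts to zero
on `Y ∖ f⁻¹K` (`K ⊆ X` closed) then `f_! y ∈ Hᵇ(X; R)` restricts to zero on `X ∖ K`*.

This file PROVES the fact for every FIELD `F` of coefficients
(`gysinMap_restrictCompl_eq_zero_of_field F : gysinMap_restrictCompl_eq_zero F`), in every universe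
and every dimension, from results proved in the tree — without Borel–Moore homology, by the
following argument on singular chains (A. Hatcher, *Algebraic Topology* (2002), §3.1 Thm. 3.2 and
p. 198, §3.3 Thm. 3.44 / Prop. 3.46; H. Miller, *Lectures on Algebraic Topology* (2020), Thm. 37.1):

* over a field, a class of `Hᵇ(U; F)` vanishes iff it pairs to zero with every `σ ∈ H_b(U; F)`
  (`kroneckerPairing_injective_of_field`), and every `σ` is carried by a compact `C ⊆ U`
  (`singularHomology.exists_isCompact_mem_range_map`);
* `capProduct_mem_range_map_compl` — if `y|_W = 0` for an open `W ⊇ C'`, `C'` closed, then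
  `y ⌢ c ∈ im (H_q(Y ∖ C') → H_q(Y))` for every `c ∈ Hₘ(Y)`: the Čech class of `y` along `C'`
  vanishes, hence so does its Čech cap product with `j_* c`, which is `j_*(y ⌢ c)` (the bridge
  `cechCap_of_univ_thetaInv` of `CechCapBridge.lean`), and the sequence of the pair is exact;
* `exists_isOpen_map_eq_zero_of_ofAbsolute_capProduct_eq_zero` — conversely, on a closed oriented
  `X`, if `j_*(x ⌢ [X]) = 0 ∈ H_q(X, X ∖ C)` then `x` vanishes on an open `V ⊇ C`: capping with
  `[X]|_C` is injective on `Ȟᵖ(C)` by Čech–Poincaré duality along every closed subset of a closed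
  oriented manifold (`HomologicalOrientation.cechDuality_res`, `PoincareDualityProofs.lean`);
* assembly: with `C ⊆ U = X ∖ K` the compact carrier of `σ` and `C' = f⁻¹C ⊆ Y ∖ f⁻¹K`,
  `f_! y ⌢ [X] = f_*(y ⌢ [Y])` (`capProduct_gysinMap`) is carried by `X ∖ C`, so `f_! y` dies on a
  neighbourhood `V` of `C` and `⟨(f_! y)|_U, σ⟩ = ⟨(f_! y)|_V, σ_V⟩ = 0` (`kroneckerPairing_map`).

* `map_eq_zero_iff_forall_ofAbsolute_capProduct_eq_zero` — the two previous points combined: over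
  a field, on a closed oriented `X`, `x|_{X ∖ K} = 0` iff `j_*(x ⌢ [X]) = 0 ∈ H_q(X, X ∖ C)` for every
  closed `C ⊆ X ∖ K` (`→` for any ring: `ofAbsolute_capProduct_eq_zero_of_map_eq_zero`) — the form
  in which `Literature/AlgebraicGeometry/HodgeTheory/GysinKernel.lean` reads kernels of restriction
  maps through Poincaré duality.

Supporting bridges proved here: `subsetCochains.homologyIsoSingularCohomology_hom_thetaInv`
(`Θ⁻¹ : Hᵖ(X) → H^p_X(X)` followed by `H^p_X(X) ≅ Hᵖ(↥univ)` is the pull-back along `↥univ → X`)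
and `subsetCochains.resH_thetaInv_eq_zero_iff` (a global class dies in `H^p_X(W)` iff it dies on
the subspace `↥W`); `res_concreteIso_hom_ofAbsolute_univ` (restricting the concrete global class).

NOT here: the fact over a general principal ideal domain `R`. There the Kronecker step fails
(`Hᵇ(U; R) → Hom_R(H_b(U; R), R)` has kernel `Ext(H_{b-1}(U; R), R)`, and a class on the open
`U = X ∖ K` vanishing near every compact subset of `U` need not vanish — a `lim¹` obstruction for
wild `K`), and the printed proofs (Fulton loc. cit.; Bredon, *Sheaf Theory* Ch. V) go through
Borel–Moore homology of `U`, `U'`, which the tree does not have. The Hodge-theoretic consumers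
(`Literature/AlgebraicGeometry/HodgeTheory/GysinKernel.lean`, `…/GysinFormalism.lean`) need exactly
`R = ℂ`.

## Collision notice (2026-08-15) — resolved

This file was first created by proposal p42387 (seat
`literature-prover-facts-Literature.AlgebraicGeometry.HodgeTheory-e148880c20-1`, commit `b16bc8268b41`)
and, four minutes later, unintentionally REPLACED wholesale by p42576 (the present content, parallel
seat `…-e148880c20-0` of the same unit, which had found no file at this path when it started); the
gate recorded the removal of p42387's ten declarations. Resolution: seat `…-1` re-landed its
duality TRANSPOSITION (cup-pairing form of Deligne's "(8.2.8.1) est la suite transposée de (8.2.8.2)")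
as `GysinTransposition.lean` (p43575): `singularCohomology.eq_zero_of_map_subsetIncl_univ_eq_zero`,
`cupProduct_eq_zero_of_map_compl_eq_zero_of_map_nhd_eq_zero`,
`kroneckerPairing_gysinMap_fundamentalClass`, `cupPairing_gysinMap`,
`ker_map_subsetIncl_compl_le_iSup_range_gysinMap`; its five remaining declarations have analogues
here — `homologyIsoSingularCohomology_hom_thetaInv`, `isoSingularCochainComplex_hom_f_coext` (here
in namespace `subsetCochains`), `res_concreteIso_ofAbsolute_univ` (here
`res_concreteIso_hom_ofAbsolute_univ`), `exists_isOpen_map_subsetIncl_eq_zero_of_ofAbsolute_eq_zero`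
and `exists_isOpen_map_subsetIncl_eq_zero_of_poincareDualityMap_eq_map` (here
`exists_isOpen_map_eq_zero_of_ofAbsolute_capProduct_eq_zero`). Anyone re-adding the originals:
append to THIS file (whole-file semantics), whose declarations are referenced by
`Literature/AlgebraicGeometry/HodgeTheory/GysinKernelProofs.lean`.

## References

* [FultonYoungTableaux1997] W. Fulton, Young Tableaux, CUP 1997, App. B §B.2 (26), (30), Exercise 5.
* [HatcherAT2002] A. Hatcher, Algebraic Topology, CUP 2002, §3.1 Thm. 3.2, p. 197–199; §3.3
  Thm. 3.44, Prop. 3.46, p. 236–239.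
* [Miller2020] H. Miller, Lectures on Algebraic Topology, World Scientific 2020, Def. 34.4, Thm. 37.1.
* [Bredon1997] G. Bredon, Sheaf Theory, GTM 170 (1997), Ch. V §10 (the Borel–Moore route, not used).
-/

noncomputable section

-- as in `CechCapBridge` / `LocalHomology`: concrete chains are `Finsupp`s and cochain complexes are
-- `(ComplexShape.down ℕ).symm`-complexes up to unfolding of semireducible definitions
set_option backward.isDefEq.respectTransparency false

open CategoryTheory Limits

universe u v

namespace Literature.AlgebraicTopology.SingularHomology

namespace subsetCochains

variable {R : Type v} [CommRing R] {X : Type u} [TopologicalSpace X]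

/-- The inverse comparison on an elementary chain: `m • τ ↦ single τ m`. [folklore] -/
lemma compIso_inv_f_single {Y : Type u} [TopologicalSpace Y] {k : ℕ} (τ : SingularSimplex Y k) (m : R) :
    (csingularChainComplex.compIso R R Y).inv.f k (singularChainComplex.single τ m) = Finsupp.single τ m := by
  rw [← csingularChainComplex.compIso_hom_f_single (R := R) (M := R) τ m, ← ModuleCat.comp_apply,
    ← HomologicalComplex.comp_f, Iso.hom_inv_id, HomologicalComplex.id_f, ModuleCat.id_apply]

/-- **Chain level**: under `Hom(C_X(univ), ULift R) ≅ C^•(↥univ; R)` (`isoSingularCochainComplex`), the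
cochain `coext φ` of a function cochain `φ` on `X` is the pull-back of `φ` along `↥univ → X`
(Hatcher 2002, §3.1 p. 197: cochains as functions on simplices). [cite: HatcherAT2002, §3.1 p. 197] -/
theorem isoSingularCochainComplex_hom_f_coext {k : ℕ} (φ : SingularSimplex X k → R) :
    (isoSingularCochainComplex R (Set.univ : Set X)).hom.f k (coext φ) =
      (singularCochainComplex.map R R
        (⟨Subtype.val, continuous_subtype_val⟩ : C(↥(Set.univ : Set X), X))).f k φ := by
  simp only [isoSingularCochainComplex, Iso.trans_hom, Iso.symm_hom, HomologicalComplex.comp_f,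
    ModuleCat.comp_apply, singularCochainComplex.cochainIso, HomologicalComplex.Hom.isoOfComponents_inv_f]
  -- cancel `XIso⁻¹` and compare morphisms `C_k(↥univ) ⟶ ULift R` on elementary chains
  apply (ModuleCat.mono_iff_injective (singularCochainComplex.XIso R R (↥(Set.univ : Set X)) k).hom).mp
    inferInstance
  rw [← ModuleCat.comp_apply, Iso.inv_hom_id]
  change (dualMap R (ModuleCat.of R (ULift.{u} R)) (csingularChainComplex.compIso R R _).inv).f k
      ((dualMap R (ModuleCat.of R (ULift.{u} R)) (subspaceIso R R X Set.univ).hom).f k (coext φ)) =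
    singularCochainComplex.XIsoFun (R := R)
      ((singularCochainComplex.map R R
        (⟨Subtype.val, continuous_subtype_val⟩ : C(↥(Set.univ : Set X), X))).f k φ)
  rw [dualMap_f_apply, dualMap_f_apply, singularCochainComplex.XIsoFun_map_f]
  refine singularChainComplex.hom_ext fun τ r => ?_
  rw [ModuleCat.comp_apply, ModuleCat.comp_apply, ModuleCat.comp_apply, compIso_inv_f_single,
    singularChainComplex.map_f_single, singularCochainComplex.XIsoFun_single]
  have hval : Subtype.val ((subspaceIso R R X (Set.univ : Set X)).hom.f k (Finsupp.single τ r)) =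
      Finsupp.single (τ.map ⟨Subtype.val, continuous_subtype_val⟩) r := by
    change Subtype.val ((((chainsInSub R R X Set.univ).lift _ (map_val_mem_chainsInSub R R Set.univ)).f k
      (Finsupp.single τ r))) = _
    rw [Subcomplex.lift_f_apply_val, csingularChainComplex.map_f_single]
  change (ULift.moduleEquiv (R := R) (M := R)).symm (Finsupp.linearCombination R φ
    (Subtype.val ((subspaceIso R R X (Set.univ : Set X)).hom.f k (Finsupp.single τ r)))) = _
  rw [hval, Finsupp.linearCombination_single]
  rfl

/-- **`Θ⁻¹` followed by `H^p_X(X; ULift R) ≅ H^p(↥univ; R)` is the pull-back along `↥univ → X`**: the two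
comparisons of the cohomology computed in `C(X)` with singular cohomology agree (Hatcher 2002, §3.1
p. 197). [cite: HatcherAT2002, §3.1 p. 197] -/
theorem homologyIsoSingularCohomology_hom_thetaInv (p : ℕ) (x : singularCohomology R R X p) :
    (homologyIsoSingularCohomology R (Set.univ : Set X) p).hom (thetaInv p x) =
      singularCohomology.map R R (⟨Subtype.val, continuous_subtype_val⟩ : C(↥(Set.univ : Set X), X)) p x := by
  obtain ⟨φ, hφ, rfl⟩ := homologyCls_surjective (K := singularCochainComplex R R X) (i := p) x
  have h := d_coext_of_mem_ker p ⟨φ, hφ⟩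
  rw [thetaInv_homologyCls p φ hφ h]
  change HomologicalComplex.homologyMap (isoSingularCochainComplex R (Set.univ : Set X)).hom p
      (homologyCls _ h) =
    HomologicalComplex.homologyMap (singularCochainComplex.map R R _) p (homologyCls φ hφ)
  rw [homologyMap_homologyCls, homologyMap_homologyCls]
  exact homologyCls_congr (isoSingularCochainComplex_hom_f_coext φ) _ _

/-- **Restriction of a global class to an open subset, in the two models**: for `x ∈ H^p(X; R)` and
`W ⊆ X`, the restriction of `Θ⁻¹ x ∈ H^p_X(X)` to `H^p_X(W)` vanishes iff the pull-back of `x` to the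
subspace `↥W` vanishes (Hatcher 2002, §3.1 p. 199, "`i*` restricts a cochain").
[cite: HatcherAT2002, §3.1 p. 199] -/
theorem resH_thetaInv_eq_zero_iff (W : Set X) (p : ℕ) (x : singularCohomology R R X p) :
    resH (Set.subset_univ W) p (thetaInv p x) = 0 ↔
      singularCohomology.map R R (⟨Subtype.val, continuous_subtype_val⟩ : C(↥W, X)) p x = 0 := by
  rw [← (homologyIsoSingularCohomology R W p).toLinearEquiv.map_eq_zero_iff]
  change (homologyIsoSingularCohomology R W p).hom (resH _ p (thetaInv p x)) = 0 ↔ _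
  rw [homologyIsoSingularCohomology_hom_resH, homologyIsoSingularCohomology_hom_thetaInv,
    ← ModuleCat.comp_apply, ← singularCohomology.map_comp]
  rfl

end subsetCochains

/-! ### Classes of `X` restricted to closed subsets: the two relative models -/

section Models

variable {R : Type v} [CommRing R] {X : Type u} [TopologicalSpace X]

/-- `concreteIso (j_* c) = cmp (c|_K)`: the class of an absolute cycle in the concrete relative model
of `(X, X ∖ K)` is the comparison image of its restriction `c|_K ∈ Hₖ(X | K)` (Hatcher 2002, §3.3
p. 236, `Hₖ(X | K) = Hₖ(X, X ∖ K)`). [cite: HatcherAT2002, §3.3 p. 236] -/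
lemma concreteIso_hom_ofAbsolute_eq_cmpIso_hom_toLocalOfSet (K : Set X) (k : ℕ)
    (c : singularHomology R R X k) :
    (relativeSingularHomology.concreteIso R R X Kᶜ k).hom
        (relativeSingularHomology.ofAbsolute R R X Kᶜ k c) =
      (localHomologyOfSet.cmpIso R R X K k).hom (singularHomology.toLocalOfSet R R X K k c) := by
  rw [localHomologyOfSet.cmpIso_hom_toLocalOfSet, ← ModuleCat.comp_apply,
    relativeSingularHomology.ofAbsolute_comp_concreteIso_hom]
  rfl

/-- **Restricting the global class**: `(j_* c computed along X)|_K = j_* c computed along K`, i.e.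
restriction `Hₖ(X | X) → Hₖ(X | K)` takes the concrete class of `c ∈ Hₖ(X)` to its concrete class
relative to `X ∖ K` (Hatcher 2002, §3.3 p. 236). [cite: HatcherAT2002, §3.3 p. 236] -/
lemma res_concreteIso_hom_ofAbsolute_univ (K : Set X) (k : ℕ) (c : singularHomology R R X k) :
    clocalHomology.res R R X (Set.subset_univ K) k
        ((relativeSingularHomology.concreteIso R R X (Set.univ : Set X)ᶜ k).hom
          (relativeSingularHomology.ofAbsolute R R X (Set.univ : Set X)ᶜ k c)) =
      (relativeSingularHomology.concreteIso R R X Kᶜ k).hom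
        (relativeSingularHomology.ofAbsolute R R X Kᶜ k c) := by
  rw [concreteIso_hom_ofAbsolute_eq_cmpIso_hom_toLocalOfSet,
    concreteIso_hom_ofAbsolute_eq_cmpIso_hom_toLocalOfSet, ← ModuleCat.comp_apply,
    localHomologyOfSet.cmpIso_hom_comp_res, ModuleCat.comp_apply,
    singularHomology.restrictLocal_toLocalOfSet]

end Models

/-! ### Support of cap products with a class vanishing on an open set -/

section Support

variable {R : Type v} [CommRing R]

/-- **A cap product with a class dying on an open `W` is carried by the complement of any closed
`C ⊆ W`**: for `y ∈ Hᵃ(Y; R)` with `y|_W = 0`, `C ⊆ W` closed and any `c ∈ Hₘ(Y; R)`,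
`y ⌢ c ∈ im (H_q(Y ∖ C) → H_q(Y))` (`a + q = m`). Proof: `Θ⁻¹ y` restricts to zero on the
neighbourhood `W` of `C`, so its Čech class along `C` vanishes, hence so does its Čech cap product
with `j_* c`, which is `j_*(y ⌢ c) ∈ H_q(Y, Y ∖ C)` (`cechCap_of_univ_thetaInv`); conclude by the
exact sequence of the pair (Hatcher 2002, §3.3 p. 239, cap product with cochains vanishing on
chains in an open set; §2.1 exactness). [cite: HatcherAT2002, §3.3 p. 239 and §2.1 Thm. 2.16] -/
theorem capProduct_mem_range_map_compl {Y : Type u} [TopologicalSpace Y] {W C : Set Y}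
    (hC : IsClosed C) (hCW : C ⊆ W) (hW : IsOpen W) {a q m : ℕ} (h : a + q = m)
    (y : singularCohomology R R Y a)
    (hy : singularCohomology.map R R (⟨Subtype.val, continuous_subtype_val⟩ : C(↥W, Y)) a y = 0)
    (c : singularHomology R R Y m) :
    capProduct h y c ∈ LinearMap.range (singularHomology.map R R
      (⟨Subtype.val, continuous_subtype_val⟩ : C(↥Cᶜ, Y)) q).hom := by
  -- the Čech class of `Θ⁻¹ y` along `C` vanishes: it is represented on `W` by `(Θ⁻¹ y)|_W = 0`
  have hres : subsetCochains.resH (Set.subset_univ W) a (subsetCochains.thetaInv a y) = 0 :=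
    (subsetCochains.resH_thetaInv_eq_zero_iff W a y).mpr hy
  have e := Cech.of_res (R := R) (N := SimplexSpan.coefR R) (K := C) (p := a) (U := OpenNhd.univ C)
    (V := ⟨W, hW, hCW⟩) (Set.subset_univ W) (subsetCochains.thetaInv a y)
  have h0 : Cech.of R (SimplexSpan.coefR R) (OpenNhd.univ C) (subsetCochains.thetaInv a y) = 0 := by
    refine e.symm.trans ?_
    change Cech.of R (SimplexSpan.coefR R) ⟨W, hW, hCW⟩
      (subsetCochains.resH (A := W) (B := Set.univ) (Set.subset_univ W) a (subsetCochains.thetaInv a y)) = 0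
    rw [hres]
    exact map_zero _
  -- hence `j_*(y ⌢ c) = 0` in `H_q(Y, Y ∖ C)`, by the bridge to the relative cap product
  have hcap := cechCap_of_univ_thetaInv hC h y (relativeSingularHomology.ofAbsolute R R Y Cᶜ m c)
  have hj' : (relativeSingularHomology.concreteIso R R Y Cᶜ q).hom
      (relativeSingularHomology.ofAbsolute R R Y Cᶜ q (capProduct h y c)) = 0 := by
    refine (relCapProduct_ofAbsolute Cᶜ h y c ▸ hcap).symm.trans ?_
    rw [h0]
    exact map_zero _
  have hj : relativeSingularHomology.ofAbsolute R R Y Cᶜ q (capProduct h y c) = 0 :=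
    (relativeSingularHomology.concreteIso R R Y Cᶜ q).toLinearEquiv.injective
      (hj'.trans (map_zero _).symm)
  -- exactness of `H_q(Y ∖ C) → H_q(Y) → H_q(Y, Y ∖ C)`
  exact LinearMap.mem_range.mpr
    (((ShortComplex.moduleCat_exact_iff _).1
      (relativeSingularHomology.exact_map_ofAbsolute R R Cᶜ q)) _ hj)

variable {n : ℕ} {X : Type u} [TopologicalSpace X] [T2Space X] [CompactSpace X]
  [ChartedSpace (EuclideanSpace ℝ (Fin n)) X]

/-- **Dually, on a closed oriented manifold: if `x ⌢ [X]` is carried by `X ∖ C` then `x` vanishes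
near `C`.** For `x ∈ Hᵖ(X; R)` and a closed `C` with `j_*(x ⌢ [X]) = 0 ∈ H_q(X, X ∖ C)`, there is an
open `V ⊇ C` with `x|_V = 0`: the Čech cap product of the Čech class of `x` along `C` with `[X]|_C`
is `j_*(x ⌢ [X]) = 0` (`cechCap_of_univ_thetaInv`), and capping with `[X]|_C` is injective —
Čech–Poincaré duality along every closed subset of a closed oriented manifold
(`HomologicalOrientation.cechDuality_res`, Miller Thm. 37.1 / Hatcher Thm. 3.44) — so the Čech
class of `x` along `C` vanishes, i.e. `x` dies on some neighbourhood of `C`.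
[cite: Miller2020, Thm. 37.1] [cite: HatcherAT2002, §3.3 Thm. 3.44 and Prop. 3.46] -/
theorem exists_isOpen_map_eq_zero_of_ofAbsolute_capProduct_eq_zero (μ : HomologicalOrientation R X n)
    {C : Set X} (hC : IsClosed C) {p q : ℕ} (h : p + q = n) (x : singularCohomology R R X p)
    (hx : relativeSingularHomology.ofAbsolute R R X Cᶜ q (capProduct h x μ.fundamentalClass) = 0) :
    ∃ V : Set X, IsOpen V ∧ C ⊆ V ∧
      singularCohomology.map R R (⟨Subtype.val, continuous_subtype_val⟩ : C(↥V, X)) p x = 0 := by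
  -- Čech duality along `C` for the restriction `[X]|_C` of the fundamental class
  have hD := μ.cechDuality_res (μ.res_fundamentalClass_point) hC p q h
  -- the Čech cap product of the class of `x` with `[X]|_C` is `j_*(x ⌢ [X]) = 0`
  have hcap : cechCap hC h (clocalHomology.res R R X (Set.subset_univ C) n
      ((relativeSingularHomology.concreteIso R R X (Set.univ : Set X)ᶜ n).hom
        (relativeSingularHomology.ofAbsolute R R X (Set.univ : Set X)ᶜ n μ.fundamentalClass)))
      (Cech.of R (SimplexSpan.coefR R) (OpenNhd.univ C) (subsetCochains.thetaInv p x)) = 0 := by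
    rw [res_concreteIso_hom_ofAbsolute_univ, cechCap_of_univ_thetaInv hC h x, relCapProduct_ofAbsolute,
      hx, map_zero]
  have h0 : Cech.of R (SimplexSpan.coefR R) (OpenNhd.univ C) (subsetCochains.thetaInv p x) = 0 :=
    hD.1 (hcap.trans (map_zero _).symm)
  obtain ⟨V, hV, hres⟩ := (Cech.of_eq_zero_iff _).mp h0
  exact ⟨V.carrier, V.isOpen, V.subset, (subsetCochains.resH_thetaInv_eq_zero_iff V.carrier p x).mp hres⟩

/-! ### The theorem over a field -/

/-- **Gysin homomorphisms are compatible with restriction to open subsets — the named fact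
`gysinMap_restrictCompl_eq_zero F` HOLDS for every field `F`** (Fulton, *Young Tableaux* App. B
§B.2 Exercise 5, read through (26) and (30); Bredon, *Sheaf Theory* V.10): if `y ∈ Hᵃ(Y; F)` dies on
`Y ∖ f⁻¹K` then `f_! y = D_X⁻¹ f_* (y ⌢ [Y])` dies on `X ∖ K`. Proof (singular chains only): over a
field `x|_U = 0` iff `⟨x|_U, σ⟩ = 0` for all `σ ∈ H_b(U; F)` (`kroneckerPairing_injective_of_field`,
Hatcher Thm. 3.2 / p. 198); a class `σ` is carried by a compact `C ⊆ U = X ∖ K`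
(`singularHomology.exists_isCompact_mem_range_map`); `y ⌢ [Y]` is carried by `Y ∖ f⁻¹C`
(`capProduct_mem_range_map_compl`), so `f_! y ⌢ [X] = f_*(y ⌢ [Y])` (`capProduct_gysinMap`) is
carried by `X ∖ C`, whence `f_! y` vanishes on a neighbourhood `V` of `C` by Čech–Poincaré duality
along `C` (`exists_isOpen_map_eq_zero_of_ofAbsolute_capProduct_eq_zero`), and
`⟨f_! y|_U, σ⟩ = ⟨f_! y|_V, σ_V⟩ = 0` by naturality of the Kronecker pairing. (Over a general
principal ideal domain the Kronecker step fails — `Hᵇ(U; R) → Hom(H_b(U; R), R)` has kernel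
`Ext(H_{b-1}(U; R), R)` — and the printed proofs go through Borel–Moore homology instead.)
[cite: FultonYoungTableaux1997, Appendix B §B.2 Exercise 5 with (26) and (30)]
[cite: HatcherAT2002, §3.1 Thm. 3.2 (p. 198), §3.3 Thm. 3.44] [cite: Miller2020, Thm. 37.1] -/
theorem gysinMap_restrictCompl_eq_zero_of_field (F : Type v) [Field F] :
    gysinMap_restrictCompl_eq_zero.{u, v} F := by
  intro m n Y X _ _ _ _ _ _ _ _ μY μX hX f a b q ha hb K hK y hy
  -- over a field it suffices to pair with every homology class `σ` of `U = X ∖ K`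
  apply kroneckerPairing_injective_of_field F _ b
  rw [map_zero]
  refine LinearMap.ext fun σ => ?_
  rw [LinearMap.zero_apply]
  -- `σ` is carried by a compact `C₀ ⊆ U`; its image `C ⊆ X ∖ K` is compact, hence closed
  obtain ⟨C₀, hC₀, β, rfl⟩ := singularHomology.exists_isCompact_mem_range_map F F σ
  set C : Set X := Subtype.val '' C₀
  have hCcl : IsClosed C := (hC₀.image continuous_subtype_val).isClosed
  have hCK : C ⊆ Kᶜ := by
    rintro _ ⟨z, _, rfl⟩
    exact z.2
  -- `y ⌢ [Y]` is carried by `Y ∖ f⁻¹C`, since `y` dies on the open `Y ∖ f⁻¹K ⊇ f⁻¹C`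
  have hC' : IsClosed (f ⁻¹' C) := hCcl.preimage f.continuous
  have hC'W : f ⁻¹' C ⊆ (f ⁻¹' K)ᶜ := fun z hz hzK => hCK hz hzK
  have hWo : IsOpen (f ⁻¹' K)ᶜ := (hK.preimage f.continuous).isOpen_compl
  obtain ⟨τ, hτ⟩ := LinearMap.mem_range.mp
    (capProduct_mem_range_map_compl hC' hC'W hWo ha y hy μY.fundamentalClass)
  -- hence `f_! y ⌢ [X] = f_*(y ⌢ [Y])` is carried by `X ∖ C`
  have hz : relativeSingularHomology.ofAbsolute F F X Cᶜ q
      (capProduct hb (gysinMap μY μX f ha hb y) μX.fundamentalClass) = 0 := by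
    let f' : C(↥(f ⁻¹' C)ᶜ, ↥Cᶜ) := subsetRestrict f (fun z hz => hz : Set.MapsTo f (f ⁻¹' C)ᶜ Cᶜ)
    have e : f.comp (⟨Subtype.val, continuous_subtype_val⟩ : C(↥(f ⁻¹' C)ᶜ, Y)) =
        (⟨Subtype.val, continuous_subtype_val⟩ : C(↥Cᶜ, X)).comp f' := by
      ext z
      rfl
    have hτ' : singularHomology.map F F (⟨Subtype.val, continuous_subtype_val⟩ : C(↥(f ⁻¹' C)ᶜ, Y)) q τ =
        capProduct ha y μY.fundamentalClass := hτ
    have e' : singularHomology.map F F f q (capProduct ha y μY.fundamentalClass) =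
        singularHomology.map F F (⟨Subtype.val, continuous_subtype_val⟩ : C(↥Cᶜ, X)) q
          (singularHomology.map F F f' q τ) := by
      rw [← hτ', ← ModuleCat.comp_apply, ← singularHomology.map_comp, e, singularHomology.map_comp,
        ModuleCat.comp_apply]
    rw [capProduct_gysinMap hX f ha hb y, e', ← ModuleCat.comp_apply,
      relativeSingularHomology.map_comp_ofAbsolute]
    rfl
  -- so `f_! y` vanishes on an open neighbourhood `V` of `C`
  obtain ⟨V, -, hCV, hxV⟩ :=
    exists_isOpen_map_eq_zero_of_ofAbsolute_capProduct_eq_zero μX hCcl hb (gysinMap μY μX f ha hb y) hz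
  -- and `⟨(f_! y)|_U, σ⟩ = ⟨(f_! y)|_V, σ'⟩ = 0` for the lift `σ'` of `σ` to `V ⊇ C₀`
  let g : C(↥C₀, ↥V) := ⟨fun z => ⟨z.1.1, hCV ⟨z.1, z.2, rfl⟩⟩, by fun_prop⟩
  have e2 : (⟨Subtype.val, continuous_subtype_val⟩ : C({x' : X // x' ∉ K}, X)).comp
      (⟨Subtype.val, continuous_subtype_val⟩ : C(↥C₀, {x' : X // x' ∉ K})) =
        (⟨Subtype.val, continuous_subtype_val⟩ : C(↥V, X)).comp g := by
    ext z
    rfl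
  rw [kroneckerPairing_map, ← ModuleCat.comp_apply, ← singularHomology.map_comp, e2,
    singularHomology.map_comp, ModuleCat.comp_apply, ← kroneckerPairing_map, hxV, map_zero,
    LinearMap.zero_apply]

/-! ### Vanishing on an open complement, characterised through the fundamental class -/

omit [T2Space X] [CompactSpace X] [ChartedSpace (EuclideanSpace ℝ (Fin n)) X] in
/-- **If `x` dies on the open `X ∖ K` then `j_*(x ⌢ [X]) = 0 ∈ H_q(X, X ∖ C)` for every closed
`C ⊆ X ∖ K`** (any coefficient ring, any class in place of `[X]`): `x ⌢ c` is carried by `X ∖ C`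
(`capProduct_mem_range_map_compl`) and `H_q(X ∖ C) → H_q(X) → H_q(X, X ∖ C)` composes to zero.
[cite: HatcherAT2002, §3.3 p. 239 and §2.1 Thm. 2.16] -/
theorem ofAbsolute_capProduct_eq_zero_of_map_eq_zero {K C : Set X} (hC : IsClosed C) (hCK : C ⊆ Kᶜ)
    (hK : IsClosed K) {p q k : ℕ} (h : p + q = k) (x : singularCohomology R R X p)
    (hx : singularCohomology.map R R (⟨Subtype.val, continuous_subtype_val⟩ : C(↥Kᶜ, X)) p x = 0)
    (c : singularHomology R R X k) :
    relativeSingularHomology.ofAbsolute R R X Cᶜ q (capProduct h x c) = 0 := by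
  obtain ⟨τ, hτ⟩ := LinearMap.mem_range.mp
    (capProduct_mem_range_map_compl hC hCK hK.isOpen_compl h x hx c)
  have hτ' : singularHomology.map R R (⟨Subtype.val, continuous_subtype_val⟩ : C(↥Cᶜ, X)) q τ =
      capProduct h x c := hτ
  rw [← hτ', ← ModuleCat.comp_apply, relativeSingularHomology.map_comp_ofAbsolute]
  rfl

/-- **Over a field, on a closed oriented manifold, `x` dies on the open `U = X ∖ K` iff
`j_*(x ⌢ [X]) = 0 ∈ H_q(X, X ∖ C)` for every closed `C ⊆ U`** — i.e. iff `x ⌢ [X]` is carried by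
every open neighbourhood of `K`. `→`: `ofAbsolute_capProduct_eq_zero_of_map_eq_zero`. `←`: by
universal coefficients over a field it suffices that `⟨x|_U, σ⟩ = 0` for all `σ ∈ H_p(U; F)`
(`kroneckerPairing_injective_of_field`); `σ` is carried by a compact `C ⊆ U`, `x` vanishes on a
neighbourhood `V` of `C` (`exists_isOpen_map_eq_zero_of_ofAbsolute_capProduct_eq_zero`, Čech–Poincaré
duality along `C`), and `⟨x|_U, σ⟩ = ⟨x|_V, σ_V⟩ = 0`. (Over `ℤ` the implication `←` fails for wild
`K`: a `lim¹` obstruction.) [cite: HatcherAT2002, §3.1 Thm. 3.2 (p. 198), §3.3 Thm. 3.44]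
[cite: Miller2020, Thm. 37.1] -/
theorem map_eq_zero_iff_forall_ofAbsolute_capProduct_eq_zero {F : Type v} [Field F]
    (μ : HomologicalOrientation F X n) {K : Set X} (hK : IsClosed K) {p q : ℕ} (h : p + q = n)
    (x : singularCohomology F F X p) :
    singularCohomology.map F F (⟨Subtype.val, continuous_subtype_val⟩ : C(↥Kᶜ, X)) p x = 0 ↔
      ∀ C : Set X, IsClosed C → C ⊆ Kᶜ →
        relativeSingularHomology.ofAbsolute F F X Cᶜ q (capProduct h x μ.fundamentalClass) = 0 := by
  refine ⟨fun hx C hC hCK => ofAbsolute_capProduct_eq_zero_of_map_eq_zero hC hCK hK h x hx _,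
    fun H => ?_⟩
  -- over a field it suffices to pair with every homology class `σ` of `U = X ∖ K`
  apply kroneckerPairing_injective_of_field F _ p
  rw [map_zero]
  refine LinearMap.ext fun σ => ?_
  rw [LinearMap.zero_apply]
  -- `σ` is carried by a compact `C₀ ⊆ U`; its image `C ⊆ X ∖ K` is compact, hence closed
  obtain ⟨C₀, hC₀, β, rfl⟩ := singularHomology.exists_isCompact_mem_range_map F F σ
  set C : Set X := Subtype.val '' C₀
  have hCcl : IsClosed C := (hC₀.image continuous_subtype_val).isClosed
  have hCK : C ⊆ Kᶜ := by
    rintro _ ⟨z, _, rfl⟩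
    exact z.2
  -- `x` vanishes on an open neighbourhood `V` of `C`
  obtain ⟨V, -, hCV, hxV⟩ :=
    exists_isOpen_map_eq_zero_of_ofAbsolute_capProduct_eq_zero μ hCcl h x (H C hCcl hCK)
  -- and `⟨x|_U, σ⟩ = ⟨x|_V, σ'⟩ = 0` for the lift `σ'` of `σ` to `V ⊇ C₀`
  let g : C(↥C₀, ↥V) := ⟨fun z => ⟨z.1.1, hCV ⟨z.1, z.2, rfl⟩⟩, by fun_prop⟩
  have e2 : (⟨Subtype.val, continuous_subtype_val⟩ : C(↥Kᶜ, X)).comp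
      (⟨Subtype.val, continuous_subtype_val⟩ : C(↥C₀, ↥Kᶜ)) =
        (⟨Subtype.val, continuous_subtype_val⟩ : C(↥V, X)).comp g := by
    ext z
    rfl
  rw [kroneckerPairing_map, ← ModuleCat.comp_apply, ← singularHomology.map_comp, e2,
    singularHomology.map_comp, ModuleCat.comp_apply, ← kroneckerPairing_map, hxV, map_zero,
    LinearMap.zero_apply]

end Support

end Literature.AlgebraicTopology.SingularHomology
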